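import Summits.Ventures.PercRepro.FaceBridge
import Summits.Ventures.PercRepro.CubeSum

/-!
# Faces without crossing pairs: three free cross edges make the antipode `⊤`

A configuration of crossing type `ab|cd` keeps `a, b` apart from `c, d`, so the four *cross* edges
`ac, ad, bc, bd` are closed (`closed_of_markedPartition_eq_cross4`). If at least three of them are
free in the face, the antipode of the face opens them (`embed_compl_of_free`) and three edges of
the 4-cycle `a–c–b–d–a` join all four marks (`conn_cycle_of_three`): the antipode is `⊤`
(`antipode_top_of_cross_free`), so such a face has no crossing pair at all
(`crossCount_eq_zero_of_antipode_top`, `FaceBridge.lean`). On a face with more than eight free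
edges of a graph with at most ten edges at most one edge is fixed (`atMostOne_of_card_face_gt`),
hence **`C005_of_K4_card_le_ten`**: C-005 at every `p` for every network with at most ten edges
whose four marks span a `K₄`. `FiveVertexC005.lean` instantiates this for the three reduced
networks on five vertices.
-/

namespace PercRepro

open Finset

variable {V E : Type}

namespace MultiGraph

/-- An open edge connects its endpoints. -/
theorem conn_of_open (G : MultiGraph V E) (ω : Config E) {e : E} (he : ω e = true) :
    G.Conn ω (G.fst e) (G.snd e) :=
  Relation.ReflTransGen.single (G.openAdj_of_open e he)

/-- An open edge connects its endpoints, either way round. -/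
theorem conn_of_open' (G : MultiGraph V E) (ω : Config E) {e : E} (he : ω e = true) {x y : V}
    (hxy : (G.fst e = x ∧ G.snd e = y) ∨ (G.fst e = y ∧ G.snd e = x)) : G.Conn ω x y := by
  rcases hxy with ⟨h1, h2⟩ | ⟨h1, h2⟩
  · rw [← h1, ← h2]
    exact G.conn_of_open ω he
  · rw [← h1, ← h2]
    exact (G.conn_of_open ω he).symm

/-- The marked partition is `⊤` when the three other marks are connected to the first. -/
theorem markedPartition_eq_top_of_conn (G : MultiGraph V E) (ω : Config E) {a b c d : V}
    (hab : G.Conn ω a b) (hac : G.Conn ω a c) (had : G.Conn ω a d) :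
    G.markedPartition ω ![a, b, c, d] = ⊤ := by
  rw [Setoid.eq_top_iff]
  intro i j
  rw [markedPartition_rel]
  have h : ∀ i : Fin 4, G.Conn ω a (![a, b, c, d] i) := by
    intro i
    fin_cases i
    · exact Conn.refl G ω a
    · exact hab
    · exact hac
    · exact had
  exact (h i).symm.trans (h j)

/-- In a crossing configuration of type `i`, an edge joining two marks separated by `cross4 i`
is closed. -/
theorem closed_of_markedPartition_eq_cross4 (G : MultiGraph V E) {ω : Config E} {m : Fin 4 → V}
    {i : Fin 3} (h : G.markedPartition ω m = cross4 i) {i' j' : Fin 4} (hsep : ¬ cross4 i i' j')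
    {e : E} (hxy : (G.fst e = m i' ∧ G.snd e = m j') ∨ (G.fst e = m j' ∧ G.snd e = m i')) :
    ω e = false := by
  by_contra hne
  have ho : ω e = true := by simpa using hne
  have hc : G.markedPartition ω m i' j' :=
    (G.markedPartition_rel ω m i' j').2 (G.conn_of_open' ω ho hxy)
  rw [h] at hc
  exact hsep hc

end MultiGraph

/-- On a face in which `e` is free, the antipode of a face point opens every free edge that the
point closes. -/
theorem embed_compl_of_free {u v : Config E} (ρ : Config (Face u v)) {e : E}
    (he : v e = false ∧ u e = true) (hclosed : embed u v ρ e = false) :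
    embed u v ρᶜ e = true := by
  rw [embed_apply_of_mem u v ρᶜ he]
  rw [embed_apply_of_mem u v ρ he] at hclosed
  exact compl_apply_of_eq_false hclosed

namespace MultiGraph

/-- Three of the four edges of the cycle `x₀–x₁–x₂–x₃–x₀` open join the four vertices: the
vertex `x₀` is connected to the three others. -/
theorem conn_cycle_of_three (G : MultiGraph V E) (ω : Config E) {x₀ x₁ x₂ x₃ : V}
    (h : (G.Conn ω x₀ x₁ ∧ G.Conn ω x₁ x₂ ∧ G.Conn ω x₂ x₃) ∨
      (G.Conn ω x₀ x₁ ∧ G.Conn ω x₁ x₂ ∧ G.Conn ω x₃ x₀) ∨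
      (G.Conn ω x₀ x₁ ∧ G.Conn ω x₂ x₃ ∧ G.Conn ω x₃ x₀) ∨
      (G.Conn ω x₁ x₂ ∧ G.Conn ω x₂ x₃ ∧ G.Conn ω x₃ x₀)) :
    G.Conn ω x₀ x₁ ∧ G.Conn ω x₀ x₂ ∧ G.Conn ω x₀ x₃ := by
  rcases h with ⟨h01, h12, h23⟩ | ⟨h01, h12, h30⟩ | ⟨h01, h23, h30⟩ | ⟨h12, h23, h30⟩
  · exact ⟨h01, h01.trans h12, (h01.trans h12).trans h23⟩
  · exact ⟨h01, h01.trans h12, h30.symm⟩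
  · exact ⟨h01, h30.symm.trans h23.symm, h30.symm⟩
  · exact ⟨(h30.symm.trans h23.symm).trans h12.symm, h30.symm.trans h23.symm, h30.symm⟩

/-- `e` is a FREE edge of the face `(u, v)` joining `x` and `y`. -/
def FreeJoin (G : MultiGraph V E) (u v : Config E) (x y : V) : Prop :=
  ∃ e, (v e = false ∧ u e = true) ∧ ((G.fst e = x ∧ G.snd e = y) ∨ (G.fst e = y ∧ G.snd e = x))

/-- Three of the four pairs of the cycle `x₀–x₁–x₂–x₃–x₀` joined by free edges. -/
def ThreeFree (G : MultiGraph V E) (u v : Config E) (x₀ x₁ x₂ x₃ : V) : Prop :=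
  (G.FreeJoin u v x₀ x₁ ∧ G.FreeJoin u v x₁ x₂ ∧ G.FreeJoin u v x₂ x₃) ∨
    (G.FreeJoin u v x₀ x₁ ∧ G.FreeJoin u v x₁ x₂ ∧ G.FreeJoin u v x₃ x₀) ∨
    (G.FreeJoin u v x₀ x₁ ∧ G.FreeJoin u v x₂ x₃ ∧ G.FreeJoin u v x₃ x₀) ∨
    (G.FreeJoin u v x₁ x₂ ∧ G.FreeJoin u v x₂ x₃ ∧ G.FreeJoin u v x₃ x₀)

/-- A free edge joining two marks separated by the crossing type of `ρ` is open in the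
antipode. -/
theorem conn_compl_of_freeJoin (G : MultiGraph V E) {u v : Config E} {ρ : Config (Face u v)}
    {m : Fin 4 → V} {i : Fin 3} (h : G.markedPartition (embed u v ρ) m = cross4 i)
    {i' j' : Fin 4} (hsep : ¬ cross4 i i' j') (hf : G.FreeJoin u v (m i') (m j')) :
    G.Conn (embed u v ρᶜ) (m i') (m j') := by
  obtain ⟨e, he, hxy⟩ := hf
  have hclosed := G.closed_of_markedPartition_eq_cross4 h hsep hxy
  exact G.conn_of_open' _ (embed_compl_of_free ρ he hclosed) hxy

/-- **The antipode of a crossing configuration is `⊤`** whenever three of the four cross pairs of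
its type are joined by free edges of the face (`ab|cd`: the cycle `a–c–b–d`; `ac|bd`: `a–b–c–d`;
`ad|bc`: `a–b–d–c`). -/
theorem antipode_top_of_cross_free (G : MultiGraph V E) {u v : Config E} {a b c d : V}
    (h0 : G.ThreeFree u v a c b d) (h1 : G.ThreeFree u v a b c d)
    (h2 : G.ThreeFree u v a b d c) (ρ : Config (Face u v)) (i : Fin 3)
    (hi : G.markedPartition (embed u v ρ) ![a, b, c, d] = cross4 i) :
    G.markedPartition (embed u v ρᶜ) ![a, b, c, d] = ⊤ := by
  have key : ∀ {x y : V} {i' j' : Fin 4}, ![a, b, c, d] i' = x → ![a, b, c, d] j' = y →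
      ¬ cross4 i i' j' → G.FreeJoin u v x y → G.Conn (embed u v ρᶜ) x y := by
    intro x y i' j' hx hy hsep hf
    subst hx hy
    exact G.conn_compl_of_freeJoin hi hsep hf
  fin_cases i
  · -- `ab|cd`: the cycle `a–c–b–d–a`
    have hsep : ∀ i' j' : Fin 4, (i' = 0 ∧ j' = 2) ∨ (i' = 2 ∧ j' = 1) ∨ (i' = 1 ∧ j' = 3) ∨
        (i' = 3 ∧ j' = 0) → ¬ cross4 0 i' j' := by
      intro i' j' h
      rw [cross4_rel]
      rcases h with ⟨rfl, rfl⟩ | ⟨rfl, rfl⟩ | ⟨rfl, rfl⟩ | ⟨rfl, rfl⟩ <;> decide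
    have hc := G.conn_cycle_of_three (embed u v ρᶜ) (x₀ := a) (x₁ := c) (x₂ := b) (x₃ := d) (by
      rcases h0 with ⟨f1, f2, f3⟩ | ⟨f1, f2, f3⟩ | ⟨f1, f2, f3⟩ | ⟨f1, f2, f3⟩
      · exact Or.inl ⟨key (i' := 0) (j' := 2) rfl rfl (hsep _ _ (by simp)) f1,
          key (i' := 2) (j' := 1) rfl rfl (hsep _ _ (by simp)) f2,
          key (i' := 1) (j' := 3) rfl rfl (hsep _ _ (by simp)) f3⟩
      · exact Or.inr (Or.inl ⟨key (i' := 0) (j' := 2) rfl rfl (hsep _ _ (by simp)) f1,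
          key (i' := 2) (j' := 1) rfl rfl (hsep _ _ (by simp)) f2,
          key (i' := 3) (j' := 0) rfl rfl (hsep _ _ (by simp)) f3⟩)
      · exact Or.inr (Or.inr (Or.inl ⟨key (i' := 0) (j' := 2) rfl rfl (hsep _ _ (by simp)) f1,
          key (i' := 1) (j' := 3) rfl rfl (hsep _ _ (by simp)) f2,
          key (i' := 3) (j' := 0) rfl rfl (hsep _ _ (by simp)) f3⟩))
      · exact Or.inr (Or.inr (Or.inr ⟨key (i' := 2) (j' := 1) rfl rfl (hsep _ _ (by simp)) f1,
          key (i' := 1) (j' := 3) rfl rfl (hsep _ _ (by simp)) f2,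
          key (i' := 3) (j' := 0) rfl rfl (hsep _ _ (by simp)) f3⟩)))
    obtain ⟨hac, hab, had⟩ := hc
    exact G.markedPartition_eq_top_of_conn _ hab hac had
  · -- `ac|bd`: the cycle `a–b–c–d–a`
    have hsep : ∀ i' j' : Fin 4, (i' = 0 ∧ j' = 1) ∨ (i' = 1 ∧ j' = 2) ∨ (i' = 2 ∧ j' = 3) ∨
        (i' = 3 ∧ j' = 0) → ¬ cross4 1 i' j' := by
      intro i' j' h
      rw [cross4_rel]
      rcases h with ⟨rfl, rfl⟩ | ⟨rfl, rfl⟩ | ⟨rfl, rfl⟩ | ⟨rfl, rfl⟩ <;> decide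
    have hc := G.conn_cycle_of_three (embed u v ρᶜ) (x₀ := a) (x₁ := b) (x₂ := c) (x₃ := d) (by
      rcases h1 with ⟨f1, f2, f3⟩ | ⟨f1, f2, f3⟩ | ⟨f1, f2, f3⟩ | ⟨f1, f2, f3⟩
      · exact Or.inl ⟨key (i' := 0) (j' := 1) rfl rfl (hsep _ _ (by simp)) f1,
          key (i' := 1) (j' := 2) rfl rfl (hsep _ _ (by simp)) f2,
          key (i' := 2) (j' := 3) rfl rfl (hsep _ _ (by simp)) f3⟩
      · exact Or.inr (Or.inl ⟨key (i' := 0) (j' := 1) rfl rfl (hsep _ _ (by simp)) f1,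
          key (i' := 1) (j' := 2) rfl rfl (hsep _ _ (by simp)) f2,
          key (i' := 3) (j' := 0) rfl rfl (hsep _ _ (by simp)) f3⟩)
      · exact Or.inr (Or.inr (Or.inl ⟨key (i' := 0) (j' := 1) rfl rfl (hsep _ _ (by simp)) f1,
          key (i' := 2) (j' := 3) rfl rfl (hsep _ _ (by simp)) f2,
          key (i' := 3) (j' := 0) rfl rfl (hsep _ _ (by simp)) f3⟩))
      · exact Or.inr (Or.inr (Or.inr ⟨key (i' := 1) (j' := 2) rfl rfl (hsep _ _ (by simp)) f1,
          key (i' := 2) (j' := 3) rfl rfl (hsep _ _ (by simp)) f2,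
          key (i' := 3) (j' := 0) rfl rfl (hsep _ _ (by simp)) f3⟩)))
    obtain ⟨hab, hac, had⟩ := hc
    exact G.markedPartition_eq_top_of_conn _ hab hac had
  · -- `ad|bc`: the cycle `a–b–d–c–a`
    have hsep : ∀ i' j' : Fin 4, (i' = 0 ∧ j' = 1) ∨ (i' = 1 ∧ j' = 3) ∨ (i' = 3 ∧ j' = 2) ∨
        (i' = 2 ∧ j' = 0) → ¬ cross4 2 i' j' := by
      intro i' j' h
      rw [cross4_rel]
      rcases h with ⟨rfl, rfl⟩ | ⟨rfl, rfl⟩ | ⟨rfl, rfl⟩ | ⟨rfl, rfl⟩ <;> decide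
    have hc := G.conn_cycle_of_three (embed u v ρᶜ) (x₀ := a) (x₁ := b) (x₂ := d) (x₃ := c) (by
      rcases h2 with ⟨f1, f2, f3⟩ | ⟨f1, f2, f3⟩ | ⟨f1, f2, f3⟩ | ⟨f1, f2, f3⟩
      · exact Or.inl ⟨key (i' := 0) (j' := 1) rfl rfl (hsep _ _ (by simp)) f1,
          key (i' := 1) (j' := 3) rfl rfl (hsep _ _ (by simp)) f2,
          key (i' := 3) (j' := 2) rfl rfl (hsep _ _ (by simp)) f3⟩
      · exact Or.inr (Or.inl ⟨key (i' := 0) (j' := 1) rfl rfl (hsep _ _ (by simp)) f1,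
          key (i' := 1) (j' := 3) rfl rfl (hsep _ _ (by simp)) f2,
          key (i' := 2) (j' := 0) rfl rfl (hsep _ _ (by simp)) f3⟩)
      · exact Or.inr (Or.inr (Or.inl ⟨key (i' := 0) (j' := 1) rfl rfl (hsep _ _ (by simp)) f1,
          key (i' := 3) (j' := 2) rfl rfl (hsep _ _ (by simp)) f2,
          key (i' := 2) (j' := 0) rfl rfl (hsep _ _ (by simp)) f3⟩))
      · exact Or.inr (Or.inr (Or.inr ⟨key (i' := 1) (j' := 3) rfl rfl (hsep _ _ (by simp)) f1,
          key (i' := 3) (j' := 2) rfl rfl (hsep _ _ (by simp)) f2,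
          key (i' := 2) (j' := 0) rfl rfl (hsep _ _ (by simp)) f3⟩)))
    obtain ⟨hab, had, hac⟩ := hc
    exact G.markedPartition_eq_top_of_conn _ hab hac had

/-- Three free edges among four given edges joining the cycle pairs, when at most one edge of the
face is not free. -/
theorem threeFree_of_atMostOne (G : MultiGraph V E) (u v : Config E) {x₀ x₁ x₂ x₃ : V}
    {e₁ e₂ e₃ e₄ : E}
    (j₁ : (G.fst e₁ = x₀ ∧ G.snd e₁ = x₁) ∨ (G.fst e₁ = x₁ ∧ G.snd e₁ = x₀))
    (j₂ : (G.fst e₂ = x₁ ∧ G.snd e₂ = x₂) ∨ (G.fst e₂ = x₂ ∧ G.snd e₂ = x₁))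
    (j₃ : (G.fst e₃ = x₂ ∧ G.snd e₃ = x₃) ∨ (G.fst e₃ = x₃ ∧ G.snd e₃ = x₂))
    (j₄ : (G.fst e₄ = x₃ ∧ G.snd e₄ = x₀) ∨ (G.fst e₄ = x₀ ∧ G.snd e₄ = x₃))
    (h12 : e₁ ≠ e₂) (h13 : e₁ ≠ e₃) (h14 : e₁ ≠ e₄) (h23 : e₂ ≠ e₃) (h24 : e₂ ≠ e₄) (h34 : e₃ ≠ e₄)
    (hone : ∀ e e', e ≠ e' → (v e = false ∧ u e = true) ∨ (v e' = false ∧ u e' = true)) :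
    G.ThreeFree u v x₀ x₁ x₂ x₃ := by
  unfold ThreeFree FreeJoin
  by_cases f1 : v e₁ = false ∧ u e₁ = true
  · by_cases f2 : v e₂ = false ∧ u e₂ = true
    · by_cases f3 : v e₃ = false ∧ u e₃ = true
      · exact Or.inl ⟨⟨e₁, f1, j₁⟩, ⟨e₂, f2, j₂⟩, ⟨e₃, f3, j₃⟩⟩
      · have f4 := (hone e₃ e₄ h34).resolve_left f3
        exact Or.inr (Or.inl ⟨⟨e₁, f1, j₁⟩, ⟨e₂, f2, j₂⟩, ⟨e₄, f4, j₄⟩⟩)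
    · have f3 := (hone e₂ e₃ h23).resolve_left f2
      have f4 := (hone e₂ e₄ h24).resolve_left f2
      exact Or.inr (Or.inr (Or.inl ⟨⟨e₁, f1, j₁⟩, ⟨e₃, f3, j₃⟩, ⟨e₄, f4, j₄⟩⟩))
  · have f2 := (hone e₁ e₂ h12).resolve_left f1
    have f3 := (hone e₁ e₃ h13).resolve_left f1
    have f4 := (hone e₁ e₄ h14).resolve_left f1
    exact Or.inr (Or.inr (Or.inr ⟨⟨e₂, f2, j₂⟩, ⟨e₃, f3, j₃⟩, ⟨e₄, f4, j₄⟩⟩))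

end MultiGraph

section Faces

variable [Fintype E] [DecidableEq E]

omit [DecidableEq E] in
/-- In a face with more than `card E − 1` free edges every edge is free. -/
theorem free_of_card_face_gt {u v : Config E} (h : Fintype.card E - 1 < Fintype.card (Face u v))
    (e : E) : v e = false ∧ u e = true := by
  by_contra hne
  have h1 := Fintype.card_subtype_lt (p := fun e : E => v e = false ∧ u e = true) hne
  have hc : Fintype.card (Face u v) = Fintype.card {x // v x = false ∧ u x = true} :=
    Fintype.card_congr (Equiv.refl _)
  omega

/-- In a face with more than `card E − 2` free edges at most one edge is not free. -/
theorem atMostOne_of_card_face_gt {u v : Config E}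
    (h : Fintype.card E - 2 < Fintype.card (Face u v)) (e e' : E) (hne : e ≠ e') :
    (v e = false ∧ u e = true) ∨ (v e' = false ∧ u e' = true) := by
  by_contra hcon
  rw [not_or] at hcon
  have hsub : ({e, e'} : Finset E) ⊆ univ.filter fun x => ¬ (v x = false ∧ u x = true) := by
    intro x hx
    rw [mem_insert, mem_singleton] at hx
    rw [mem_filter]
    rcases hx with rfl | rfl
    · exact ⟨mem_univ _, hcon.1⟩
    · exact ⟨mem_univ _, hcon.2⟩
  have h2 : 2 ≤ (univ.filter fun x => ¬ (v x = false ∧ u x = true)).card :=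
    (card_pair hne).symm.le.trans (card_le_card hsub)
  have hsum := card_filter_add_card_filter_not (s := (univ : Finset E))
    (p := fun x => v x = false ∧ u x = true)
  rw [card_univ] at hsum
  have hface : Fintype.card (Face u v) = (univ.filter fun x => v x = false ∧ u x = true).card :=
    (Fintype.card_congr (Equiv.refl _)).trans (Fintype.card_subtype _)
  omega

end Faces

namespace MultiGraph

/-- **C-005 for every network with at most ten edges whose marks span a `K₄`** (an edge between
every two of the four marks), at every `p`: on a face with more than eight free edges at most one
edge is fixed, so three of the four cross edges of every crossing type are free and no crossing
pair exists; the other faces are covered by the 8-point code bound. -/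
theorem C005_of_K4_card_le_ten [Fintype E] [DecidableEq E] (G : MultiGraph V E)
    (hE : Fintype.card E ≤ 10)
    {a b c d : V} {eab eac ead ebc ebd ecd : E}
    (hab : (G.fst eab = a ∧ G.snd eab = b) ∨ (G.fst eab = b ∧ G.snd eab = a))
    (hac : (G.fst eac = a ∧ G.snd eac = c) ∨ (G.fst eac = c ∧ G.snd eac = a))
    (had : (G.fst ead = a ∧ G.snd ead = d) ∨ (G.fst ead = d ∧ G.snd ead = a))
    (hbc : (G.fst ebc = b ∧ G.snd ebc = c) ∨ (G.fst ebc = c ∧ G.snd ebc = b))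
    (hbd : (G.fst ebd = b ∧ G.snd ebd = d) ∨ (G.fst ebd = d ∧ G.snd ebd = b))
    (hcd : (G.fst ecd = c ∧ G.snd ecd = d) ∨ (G.fst ecd = d ∧ G.snd ecd = c))
    (h1 : eab ≠ eac) (h2 : eab ≠ ead) (h3 : eab ≠ ebc) (h4 : eab ≠ ebd) (h5 : eab ≠ ecd)
    (h6 : eac ≠ ead) (h7 : eac ≠ ebc) (h8 : eac ≠ ebd) (h9 : eac ≠ ecd) (h10 : ead ≠ ebc)
    (h11 : ead ≠ ebd) (h12 : ead ≠ ecd) (h13 : ebc ≠ ebd) (h14 : ebc ≠ ecd) (h15 : ebd ≠ ecd)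
    (p : E → ℝ) (hp : IsProb p) :
    prob p (G.partitionEvent ![a, b, c, d] ![0, 0, 1, 1]) *
        prob p (G.partitionEvent ![a, b, c, d] ![0, 1, 0, 1]) +
      prob p (G.partitionEvent ![a, b, c, d] ![0, 0, 1, 1]) *
        prob p (G.partitionEvent ![a, b, c, d] ![0, 1, 1, 0]) +
      prob p (G.partitionEvent ![a, b, c, d] ![0, 1, 0, 1]) *
        prob p (G.partitionEvent ![a, b, c, d] ![0, 1, 1, 0]) ≤
    prob p (G.partitionEvent ![a, b, c, d] ![0, 0, 0, 0]) *
      prob p (G.partitionEvent ![a, b, c, d] ![0, 1, 2, 3]) := by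
  refine G.C005_of_faceMaps a b c d (fun u v _ => ?_) p hp
  by_cases h8' : Fintype.card (Face u v) ≤ 8
  · exact G.faceMap_lemmaB_of_card_le_eight _ u v h8'
  · have hone := atMostOne_of_card_face_gt (u := u) (v := v) (by omega)
    rw [crossCount_eq_zero_of_antipode_top]
    · exact Nat.zero_le _
    · intro ρ i hi
      exact G.antipode_top_of_cross_free (a := a) (b := b) (c := c) (d := d)
        (G.threeFree_of_atMostOne u v (e₁ := eac) (e₂ := ebc) (e₃ := ebd) (e₄ := ead)
          hac hbc.symm hbd had.symm
          h7 h8 h6 h13 h10.symm h11.symm hone)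
        (G.threeFree_of_atMostOne u v (e₁ := eab) (e₂ := ebc) (e₃ := ecd) (e₄ := ead)
          hab hbc hcd had.symm h3 h5 h2 h14 h10.symm h12.symm hone)
        (G.threeFree_of_atMostOne u v (e₁ := eab) (e₂ := ebd) (e₃ := ecd) (e₄ := eac)
          hab hbd hcd.symm hac.symm
          h4 h5 h1 h15 h8.symm h9.symm hone) ρ i hi

end MultiGraph

end PercRepro
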